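import Literature.AlgebraicTopology.SingularHomology.LocalHomology
import Literature.AlgebraicTopology.SingularHomology.HomDualComplex
import Mathlib.LinearAlgebra.Basis.VectorSpace
import Mathlib.LinearAlgebra.Isomorphisms
import HarnessLib

/-!
# Lifting cocycles along a degreewise surjective quasi-isomorphism, and cocycles vanishing on cycles

Two pieces of linear homological algebra over a ring / a field, for the comparison of de Rham
and singular cochains "by testing on smooth cycles" (`Literature/Geometry/Manifold/DeRhamCupProduct`):

* `exists_cocycle_lift` — **a chain map `ρ : S ⟶ D` of complexes of modules that is surjective in
  every degree and bijective on the homology in degree `i` is surjective on `i`-cocycles**: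
  every cocycle `ψ ∈ Dⁱ` is `ρ φ` for a cocycle `φ ∈ Sⁱ` (take any cocycle `φ₀` with
  `[ρ φ₀] = [ψ]`, write `ρ φ₀ - ψ = d w`, lift `w`, and correct `φ₀` by `d w̃`);
* `dual_homologyCls_eq_zero_of_forall_cycle` — **over a field, a cocycle of the dual complex
  `Hom(K, N)` of a chain complex `K` that vanishes on all cycles is a coboundary** (it factors
  through `Kₙ / Zₙ ≅ Bₙ₋₁ ⊆ Kₙ₋₁` and linear functionals extend from subspaces,
  `LinearMap.exists_extend`); hence two cocycles agreeing on cycles have the same class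
  (`dual_homologyCls_eq_of_forall_cycle`) — the trivial direction of the universal coefficient
  theorem (Hatcher (2002), §3.1, p. 191 / Thm. 3.2).

Everything is proved; no named facts.

## References

* A. Hatcher, *Algebraic Topology*, CUP 2002, §3.1 pp. 190–199. [HatcherAT2002]
-/

noncomputable section

open CategoryTheory

universe w v t

namespace Literature.AlgebraicTopology.SingularHomology

/-! ### Lifting cocycles -/

section Lift

variable {R : Type v} [CommRing R] {ι : Type t} {c : ComplexShape ι}
  {S D : HomologicalComplex (ModuleCat.{w} R) c}

/-- **A degreewise surjective chain map inducing a bijection on `Hⁱ` is surjective on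
`i`-cocycles.** [cite: HatcherAT2002, §3.1 p. 199] -/
theorem exists_cocycle_lift (ρ : S ⟶ D) (hsurj : ∀ j, Function.Surjective (ρ.f j)) (i : ι)
    (hbij : Function.Bijective (HomologicalComplex.homologyMap ρ i)) (ψ : D.X i) (hψ : D.d i (c.next i) ψ = 0) :
    ∃ φ : S.X i, S.d i (c.next i) φ = 0 ∧ ρ.f i φ = ψ := by
  -- a cocycle `φ₀` with `[ρ φ₀] = [ψ]`
  obtain ⟨x, hx⟩ := hbij.2 (homologyCls ψ hψ)
  obtain ⟨φ₀, hφ₀, rfl⟩ := homologyCls_surjective x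
  rw [homologyMap_homologyCls] at hx
  -- `ρ φ₀ - ψ = d w`
  obtain ⟨w, hw⟩ := (homologyCls_eq_homologyCls_iff _ _ (d_hom_f_eq_zero ρ φ₀ hφ₀) hψ).1 hx
  -- lift `w`
  obtain ⟨w', rfl⟩ := hsurj _ w
  refine ⟨φ₀ - S.d (c.prev i) i w', ?_, ?_⟩
  · rw [map_sub, hφ₀, ← ModuleCat.comp_apply, S.d_comp_d]
    simp
  · rw [map_sub, ← ModuleCat.comp_apply, ← ρ.comm, ModuleCat.comp_apply, hw, sub_sub_cancel]

end Lift

/-! ### Cocycles of a dual complex vanishing on cycles -/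

section Dual

variable {R : Type v} [Field R] {N : ModuleCat.{w} R} {K : HomologicalComplex (ModuleCat.{w} R) (ComplexShape.down ℕ)}

/-- `next 0 = 0` for the homological shape — Mathlib's `ChainComplex.next_nat_zero`; kept as a
deprecated alias (librarian dedup-01981). [folklore] -/
@[deprecated ChainComplex.next_nat_zero (since := "2026-08-16")]
alias down_next_zero := ChainComplex.next_nat_zero

/-- Every `0`-chain is a cycle. [folklore] -/
theorem d_zero_next_apply (z : K.X 0) : K.d 0 ((ComplexShape.down ℕ).next 0) z = 0 := by
  rw [K.shape]
  · rfl
  · rw [ChainComplex.next_nat_zero]; change ¬((0 : ℕ) + 1 = 0); omega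

/-- **Over a field, a cocycle of `Hom(K, N)` vanishing on all cycles of `K` is a coboundary.**
[cite: HatcherAT2002, §3.1 p. 191] -/
theorem dual_homologyCls_eq_zero_of_forall_cycle (n : ℕ) (ψ : (dualObj R N K).X n)
    (hψ : (dualObj R N K).d n ((ComplexShape.down ℕ).symm.next n) ψ = 0)
    (hvan : ∀ z : K.X n, K.d n ((ComplexShape.down ℕ).next n) z = 0 → (ModuleCat.Hom.hom ψ) z = 0) :
    homologyCls ψ hψ = 0 := by
  rw [homologyCls_eq_zero_iff]
  cases n with
  | zero =>
    -- every `0`-chain is a cycle, so `ψ = 0`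
    have h0 : ψ = 0 := by
      refine ModuleCat.hom_ext (LinearMap.ext fun z ↦ ?_)
      rw [hvan z (d_zero_next_apply z)]
      rfl
    refine ⟨0, ?_⟩
    rw [map_zero, h0]
  | succ n =>
    rw [exists_d_prev_eq_iff ((ComplexShape.down ℕ).symm.prev_eq' (rfl : n + 1 = n + 1))]
    -- the boundary `∂ : K_{n+1} → K_n` and the factorisation of `ψ` through its range
    set f : K.X (n + 1) →ₗ[R] K.X n := (K.d (n + 1) n).hom with hf
    have hker : LinearMap.ker f ≤ LinearMap.ker (ModuleCat.Hom.hom ψ) := by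
      intro z hz
      rw [LinearMap.mem_ker] at hz ⊢
      refine hvan z ?_
      rw [(ComplexShape.down ℕ).next_eq' (rfl : n + 1 = n + 1)]
      exact hz
    set θ₀ : LinearMap.range f →ₗ[R] N := (LinearMap.ker f).liftQ (ModuleCat.Hom.hom ψ) hker ∘ₗ f.quotKerEquivRange.symm.toLinearMap
      with hθ₀
    obtain ⟨θ, hθ⟩ := LinearMap.exists_extend θ₀
    refine ⟨ModuleCat.ofHom θ, ?_⟩
    rw [dualObj_d_apply]
    refine ModuleCat.hom_ext (LinearMap.ext fun z ↦ ?_)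
    rw [ModuleCat.hom_comp, LinearMap.comp_apply, ModuleCat.hom_ofHom]
    have hmem : f z ∈ LinearMap.range f := LinearMap.mem_range_self f z
    have h1 : θ (f z) = θ₀ ⟨f z, hmem⟩ := by
      rw [← hθ]; rfl
    change θ (f z) = _
    rw [h1, hθ₀, LinearMap.comp_apply, LinearEquiv.coe_toLinearMap, LinearMap.quotKerEquivRange_symm_apply_image]
    rfl

/-- **Two cocycles of `Hom(K, N)` that agree on all cycles of `K` have the same class** (over a
field). [cite: HatcherAT2002, §3.1 p. 191] -/
theorem dual_homologyCls_eq_of_forall_cycle (n : ℕ) (ψ₁ ψ₂ : (dualObj R N K).X n)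
    (h₁ : (dualObj R N K).d n ((ComplexShape.down ℕ).symm.next n) ψ₁ = 0)
    (h₂ : (dualObj R N K).d n ((ComplexShape.down ℕ).symm.next n) ψ₂ = 0)
    (hagree : ∀ z : K.X n, K.d n ((ComplexShape.down ℕ).next n) z = 0 →
      (ModuleCat.Hom.hom ψ₁) z = (ModuleCat.Hom.hom ψ₂) z) :
    homologyCls ψ₁ h₁ = homologyCls ψ₂ h₂ := by
  rw [← sub_eq_zero, ← homologyCls_sub ψ₁ ψ₂ h₁ h₂ (by rw [map_sub, h₁, h₂, sub_zero])]
  refine dual_homologyCls_eq_zero_of_forall_cycle n _ _ fun z hz ↦ ?_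
  have : (ModuleCat.Hom.hom (ψ₁ - ψ₂)) z = (ModuleCat.Hom.hom ψ₁) z - (ModuleCat.Hom.hom ψ₂) z := rfl
  rw [this, hagree z hz, sub_self]

end Dual

end Literature.AlgebraicTopology.SingularHomology
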